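import Summits.ValiantsHypothesis.ValiantsHypothesis.Theorems.GeneratorObstructionsPerGenDegreeSuperQPFermatChow

/-!
# Route GeneratorObstructions — K1 `PerGenDegreeSuperQP` (stmt-ValiantsHypothesis-11654),
# line `per-side-atoms`: the ray `j = m + 1` of `S(per_m)` is hit — `y₁⋯y_m + z^m` is the
# degeneration `per_m(diag(y) + z·C)` of the permanent

Seventeenth support file of the line; consequences of `…FermatChow` (the Fermat–Chow form
`q_m = y₁⋯y_m + z^m` is polystable; permutations supported on the diagonal and the cyclic
sub-diagonal are `1` and the shift) and of the ray criterion (`…RayCriterion`):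

* `exists_linSubst_cycleDiag`, `linSubst_cycleDiag_perFormLex` — the linear endomorphism
  `x_{cc} ↦ x_{cc}`, `x_{r,r+1} ↦ x_{01}`, other `x ↦ 0` of the matrix variables carries `per_m`
  to `x₁₁⋯x_mm + x₀₁^m`: in `per_m = ∑_σ ∏_i x_{σ(i), i}` only `σ = 1` and the backward shift
  survive;
* `fermatChow_mem_orbitClosure_per` — hence `q_m`, placed at `y_i ↦ x_{ii}`, `z ↦ x_{01}`, lies in
  `End·per_m ⊆ Δ(per_m)`;
* `per_ray_succ_hit`, `per_exists_ray_atom_succ` — **the ray `j = m + 1` of `S(per_m)` is hit and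
  carries an atom** `(k₀^{m+1})^*` of degree in `[m+1, e(q_m)]` (`m ≥ 2`).

For `m` prime the known hit rays of `S(per_m)` are now `1, m, m + 1, m²` (`…BiCollapsedPermanentRays`
gives the products of two divisors). The first-occurrence degrees — a super-quasi-polynomial one,
infinitely often, is the registered `stub_atomLate` — remain open. Honest framing: unconditional
structure theorems; `stub_atomLate` (`c ≥ 2`), K1 and `GenFlipThesis` remain OPEN; nothing here
bears on VP versus VNP. References: [BurgisserIkenmeyer2017] Prop. 2.8, Def. 3.3;
[MulmuleySohoni2001] §4.
-/

set_option linter.dupNamespace false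

noncomputable section

namespace Summit.ValiantsHypothesis.ValiantsHypothesis.Theorems.GeneratorObstructions.PerGenDegreeSuperQP

open MvPolynomial
open Literature.NumberTheory.DiophantineGeometry Literature.Computability.AlgebraicComplexity
  Literature.Computability.Complexity

/-! ### `y₁⋯y_m + z^m = per_m(diag(y) + z·C)` is a degeneration of the permanent -/

section Degeneration

variable {m : ℕ} [NeZero m]

/-- `1 ≠ 0` in `ℤ/m` for `m ≥ 2`. [folklore] -/
theorem fin_one_ne_zero (hm : 2 ≤ m) : (1 : Fin m) ≠ 0 := by
  obtain ⟨n, rfl⟩ : ∃ n, m = n + 1 := ⟨m - 1, by omega⟩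
  rw [Ne, Fin.one_eq_zero_iff]
  omega

/-- **The substitution `x_{ik} ↦ (diag(y) + z·C)_{ik}`** as a linear endomorphism of the matrix
variables: the diagonal variable `x_{cc}` is kept, the cyclic sub-diagonal variable `x_{r, r+1}`
goes to the single variable `x_{01}`, every other variable to `0`. [folklore] -/
theorem exists_linSubst_cycleDiag (hm : 2 ≤ m) :
    ∃ A : Matrix (MatIdx m) (MatIdx m) ℂ, ∀ r c : Fin m,
      linSubst (MatIdx m) ℂ A (X (toLex (r, c) : MatIdx m)) =
        if r = c then X (toLex (c, c) : MatIdx m)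
        else if r + 1 = c then X (toLex ((0 : Fin m), (1 : Fin m)) : MatIdx m) else 0 := by
  classical
  have h10 := fin_one_ne_zero hm
  refine ⟨Matrix.of fun y x : MatIdx m => if (ofLex x).1 = (ofLex x).2 ∧ y = x then (1 : ℂ)
      else if (ofLex x).1 + 1 = (ofLex x).2 ∧ y = toLex ((0 : Fin m), (1 : Fin m)) then 1 else 0,
    fun r c => ?_⟩
  rw [linSubst_X]
  simp only [Matrix.of_apply, ofLex_toLex]
  by_cases hrc : r = c
  · subst hrc
    have hr1 : ¬ (r + 1 = r) := fun h => h10 (by simpa using h)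
    rw [if_pos rfl, Finset.sum_eq_single (toLex (r, r) : MatIdx m)]
    · simp
    · intro y _ hy
      rw [if_neg (fun h => hy h.2), if_neg (fun h => hr1 h.1), zero_smul]
    · intro h; exact absurd (Finset.mem_univ _) h
  · rw [if_neg hrc]
    by_cases hrc1 : r + 1 = c
    · rw [if_pos hrc1, Finset.sum_eq_single (toLex ((0 : Fin m), (1 : Fin m)) : MatIdx m)]
      · rw [if_neg (fun h => hrc h.1), if_pos ⟨hrc1, rfl⟩, one_smul]
      · intro y _ hy
        rw [if_neg (fun h => hrc h.1), if_neg (fun h => hy h.2), zero_smul]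
      · intro h; exact absurd (Finset.mem_univ _) h
    · rw [if_neg hrc1]
      refine Finset.sum_eq_zero fun y _ => ?_
      rw [if_neg (fun h => hrc h.1), if_neg (fun h => hrc1 h.1), zero_smul]

/-- **`per_m(diag(y) + z·C) = y₁⋯y_m + z^m`**: under the substitution of
`exists_linSubst_cycleDiag` only the identity and the cyclic shift survive in the permutation
expansion of `per_m` (`eq_one_or_eq_subRight`). [folklore] -/
theorem linSubst_cycleDiag_perFormLex (hm : 2 ≤ m) {A : Matrix (MatIdx m) (MatIdx m) ℂ}
    (hA : ∀ r c : Fin m, linSubst (MatIdx m) ℂ A (X (toLex (r, c) : MatIdx m)) =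
      if r = c then X (toLex (c, c) : MatIdx m)
      else if r + 1 = c then X (toLex ((0 : Fin m), (1 : Fin m)) : MatIdx m) else 0) :
    linSubst (MatIdx m) ℂ A
        (MvPolynomial.rename (toLex : Fin m × Fin m → MatIdx m) (perPoly (Fin m) ℂ)) =
      (∏ i : Fin m, X (toLex (i, i) : MatIdx m)) + X (toLex ((0 : Fin m), (1 : Fin m)) : MatIdx m) ^ m := by
  classical
  have h10 := fin_one_ne_zero hm
  rw [perFormLex_eq_sum, map_sum]
  simp only [map_prod, hA]
  rw [Fintype.sum_eq_add (1 : Equiv.Perm (Fin m)) (Equiv.subRight (1 : Fin m))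
    (subRight_one_ne_one hm).symm]
  · congr 1
    · simp
    · have hterm : ∀ i : Fin m,
          (if (Equiv.subRight (1 : Fin m)) i = i then (X (toLex (i, i) : MatIdx m) : MvPolynomial (MatIdx m) ℂ)
            else if (Equiv.subRight (1 : Fin m)) i + 1 = i
              then X (toLex ((0 : Fin m), (1 : Fin m)) : MatIdx m) else 0) =
          X (toLex ((0 : Fin m), (1 : Fin m)) : MatIdx m) := by
        intro i
        have hne : ¬ (i - 1 = i) := fun h => h10 (by simpa using h)
        rw [Equiv.subRight_apply, if_neg hne, if_pos (sub_add_cancel i 1)]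
      rw [Finset.prod_congr rfl fun i _ => hterm i, Finset.prod_const, Finset.card_univ,
        Fintype.card_fin]
  · rintro σ ⟨h1, h2⟩
    have h : ¬ ∀ i, σ i = i ∨ σ i + 1 = i := by
      intro h
      rcases eq_one_or_eq_subRight hm σ h with h' | h'
      · exact h1 h'
      · exact h2 h'
    push Not at h
    obtain ⟨i, hi1, hi2⟩ := h
    exact Finset.prod_eq_zero (Finset.mem_univ i) (by rw [if_neg hi1, if_neg hi2])

/-- **`y₁⋯y_m + z^m` is an `(m+1)`-variable degeneration of `per_m`** (`m ≥ 2`): placed with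
`y_i ↦ x_{ii}`, `z ↦ x_{01}`, it is `per_m(diag(y) + z·C)`, a point of `End·per_m ⊆ Δ(per_m)`.
[cite: MulmuleySohoni2001, §4] -/
theorem fermatChow_mem_orbitClosure_per (hm : 2 ≤ m) :
    MvPolynomial.rename
        (Fin.lastCases (motive := fun _ => MatIdx m) (toLex ((0 : Fin m), (1 : Fin m)))
          (fun i : Fin m => (toLex (i, i) : MatIdx m)))
        ((∏ i : Fin m, X (Fin.castSucc i)) + X (Fin.last m) ^ m : MvPolynomial (Fin (m + 1)) ℂ) ∈
      orbitClosure (MvPolynomial.rename (toLex : Fin m × Fin m → MatIdx m) (perPoly (Fin m) ℂ)) := by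
  haveI : Infinite ℂ := CharZero.infinite ℂ
  obtain ⟨A, hA⟩ := exists_linSubst_cycleDiag hm
  have hq : MvPolynomial.rename
        (Fin.lastCases (motive := fun _ => MatIdx m) (toLex ((0 : Fin m), (1 : Fin m)))
          (fun i : Fin m => (toLex (i, i) : MatIdx m)))
        ((∏ i : Fin m, X (Fin.castSucc i)) + X (Fin.last m) ^ m : MvPolynomial (Fin (m + 1)) ℂ) =
      (∏ i : Fin m, X (toLex (i, i) : MatIdx m)) + X (toLex ((0 : Fin m), (1 : Fin m)) : MatIdx m) ^ m := by
    simp [map_add, map_prod, map_pow, rename_X, Fin.lastCases_castSucc, Fin.lastCases_last]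
  rw [hq, ← linSubst_cycleDiag_perFormLex hm hA]
  exact endOrbit_subset_orbitClosure_holds (k := ℂ) (σ := MatIdx m) _ ⟨A, rfl⟩

end Degeneration

/-! ### The ray `j = m + 1` of `S(per_m)` is hit and carries an atom -/

section Ray

variable {m : ℕ}

/-- **The ray `m + 1` is hit** (`m ≥ 2`): `(k^{m+1})^*` occurs in `ℂ[Δ_m[per_m]]` for some `k ≥ 1`
— the Fermat–Chow form `y₁⋯y_m + z^m` is a polystable (`isPolystable_fermatChow`), hence
`SL_{m+1}`-semistable, `(m+1)`-variable degeneration of `per_m` (`fermatChow_mem_orbitClosure_per`);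
then the ray criterion. This ray is NOT of the product form `r₁ r₂` (`r_i ∣ m`) of the companion
files unless `m + 1 ∣ m²`, i.e. never for `m ≥ 2`: e.g. for `m` prime the known hit rays are now
`1, m, m + 1, m²`. [cite: BurgisserIkenmeyer2017, Prop. 2.8 and Def. 3.3] -/
theorem per_ray_succ_hit (hm : 2 ≤ m) :
    ∃ k : ℕ, 0 < k ∧
      highestWeightSpace (orbitCoordRep (MvPolynomial.rename toLex (perPoly (Fin m) ℂ)) m)
        (partitionWeightLex m (Nat.Partition.rectangle (m + 1) k)) ≠ ⊥ := by
  haveI : NeZero m := ⟨by omega⟩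
  have h10 := fin_one_ne_zero hm
  have hκ : Function.Injective
      (Fin.lastCases (motive := fun _ => MatIdx m) (toLex ((0 : Fin m), (1 : Fin m)))
        (fun i : Fin m => (toLex (i, i) : MatIdx m))) := by
    intro a b hab
    rcases Fin.eq_castSucc_or_eq_last a with ⟨i, rfl⟩ | rfl <;>
      rcases Fin.eq_castSucc_or_eq_last b with ⟨k, rfl⟩ | rfl
    · simp only [Fin.lastCases_castSucc] at hab
      have := congrArg (fun x : MatIdx m => (ofLex x).1) hab
      simp only [ofLex_toLex] at this
      rw [this]
    · exfalso
      simp only [Fin.lastCases_castSucc, Fin.lastCases_last] at hab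
      have h1 := congrArg (fun x : MatIdx m => (ofLex x).1) hab
      have h2 := congrArg (fun x : MatIdx m => (ofLex x).2) hab
      simp only [ofLex_toLex] at h1 h2
      subst h1
      exact h10 h2.symm
    · exfalso
      simp only [Fin.lastCases_castSucc, Fin.lastCases_last] at hab
      have h1 := congrArg (fun x : MatIdx m => (ofLex x).1) hab
      have h2 := congrArg (fun x : MatIdx m => (ofLex x).2) hab
      simp only [ofLex_toLex] at h1 h2
      subst h1
      exact h10 h2
    · rfl
  obtain ⟨k, hk, hocc⟩ := exists_hasHighestWeight_rectangle_of_isSLSemistable_projection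
    (matIdxEquiv m) (show m ≠ 0 by omega) (perFormLex_isHomogeneous m) (Nat.succ_pos m) _ hκ
    (fermatChow_isHomogeneous m) (fermatChow_mem_orbitClosure_per hm)
    ((isPolystable_fermatChow hm).isSLSemistable (fermatChow_ne_zero (by omega)))
  exact ⟨k, hk, hocc⟩

/-- **The ray `m + 1` carries an atom** (`m ≥ 2`): `S(per_m)` has an atom `(k₀^{m+1})^*`,
`k₀ ≥ 1`, the first weight on the ray — of degree `(m+1)k₀/m ≥ m + 1`, at most the minimal
degree `e(y₁⋯y_m + z^m)` of the Fermat–Chow form. [cite: BurgisserIkenmeyer2017, Prop. 2.8 and Def. 3.3] -/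
theorem per_exists_ray_atom_succ (hm : 2 ≤ m) :
    ∃ k₀ : ℕ, 0 < k₀ ∧
      highestWeightSpace (orbitCoordRep (MvPolynomial.rename toLex (perPoly (Fin m) ℂ)) m)
        (partitionWeightLex m (Nat.Partition.rectangle (m + 1) k₀)) ≠ ⊥ ∧
      (∀ k : ℕ, 0 < k → k < k₀ →
        highestWeightSpace (orbitCoordRep (MvPolynomial.rename toLex (perPoly (Fin m) ℂ)) m)
          (partitionWeightLex m (Nat.Partition.rectangle (m + 1) k)) = ⊥) ∧
      (∀ χ₁ χ₂ : Weight (MatIdx m), χ₁ + χ₂ = partitionWeightLex m (Nat.Partition.rectangle (m + 1) k₀) →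
        χ₁ ≠ 0 → χ₂ ≠ 0 →
        highestWeightSpace (orbitCoordRep (MvPolynomial.rename toLex (perPoly (Fin m) ℂ)) m) χ₁ = ⊥ ∨
          highestWeightSpace (orbitCoordRep (MvPolynomial.rename toLex (perPoly (Fin m) ℂ)) m) χ₂ = ⊥) :=
  exists_least_rectangle_atom _ _ (Nat.succ_pos m) (by nlinarith) (per_ray_succ_hit hm)

end Ray

end Summit.ValiantsHypothesis.ValiantsHypothesis.Theorems.GeneratorObstructions.PerGenDegreeSuperQP

end
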